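import Summits.BirchSwinnertonDyer.BirchSwinnertonDyer.Theorems.ThetaPartnerAtTwoSignedMainConjectureCMTwoRankZeroGeneratorChange
import Summits.BirchSwinnertonDyer.BirchSwinnertonDyer.Theorems.ThetaPartnerAtTwoSignedMainConjectureCMTwoRankZero
import HarnessLib

/-!
# Route `ThetaPartnerAtTwo`, crux K2r `SignedMainConjectureCMTwoRankZero` (item stmt-BirchSwinnertonDyer-20312):
# two reductions of the remaining stubs — torsion from bottom-layer signed control at ONE normalised
# pair, and the Eisenstein half is free in the UNIT ZONE

HONEST FRAMING (cell `pub/bsd-wall`, W-ALL row 1, prover seat `bsd-wall-tp2-p2`, successor g1): after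
the generator-change stub landed (p526353), the skeleton `rankzero` of the restated crux has four
research stubs — (T2_A) torsion of `X⁺(A/ℚ_∞)` at `2`, (K4c_A) Kim's control term at `2`, (E_A) the
Eisenstein half `KobayashiLowerDivisibility A 2 1`, (μ♭_A) the analytic `μ` — plus cited PUB. This file
sharpens two of them WITHOUT asserting anything about any curve:

* §1 `signedTorsion_two_of_finite_invariants_normalised` — (T2_A) follows, for every cyclotomic
  top-generator pair, from the finiteness of `Sel⁺(A/ℚ_∞)^γ` at the NORMALISED pairs alone
  (`IsCyclotomicVariable 2 γ`): Greenberg's Thm. 1.4 / Lemma 4.2 mechanism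
  (`SignedSelmerDualData.isTorsion_of_finite_endInvariants`, tree) gives torsion there, and the landed
  generator change (`SignedSelmerDualData.isTorsion_of_isTorsion_of_isCyclotomic`, p525626) moves it to
  every pair. So (T2_A) = bottom-layer signed control at `2` for the rank-`0` CM curve (Kobayashi
  Thm. 9.3 at `n = 0`, printed for odd `p`) — the SAME open input as crux 19097 stub
  `stub_zeroSignedEulerChar`.1 and crux 20333 stub `stub_torsion2`, read for `A` instead of `W`.
* §2 `kobayashiLowerDivisibility_body_of_unitZone_two` — (E_A) is FREE in the unit zone: for `W` good
  supersingular at `2` with `a₂ = 0`, a newform `f` with period ratio `ϖ` a `2`-adic unit and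
  `[0]⁺_f = L(f,1)/Ω⁺_f` a `2`-adic unit, ANY Pollack pair at `2` and ANY datum `D`: the body of
  `KobayashiLowerDivisibility W 2 1` holds at these data (`L⁻ = L♭` is a unit of `Λ` since
  `L♭(0) = [0]⁺_f`, so `ϖ·L♭` divides every `g`). Hence (E_A) has content only OUTSIDE the unit zone —
  e.g. on the rank-`0` twists of the `d ≠ 3` anchors, where `λ♭ ≥ 1` (kit j273215: 3249a1 `λ♭ = 3`).

References: [Kobayashi2003] Thm. 1.2, Thm. 9.3, Conjecture (p. 2); [GreenbergLNM1716] Thm. 1.4 (p. 61),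
§4 Lemma 4.2 (p. 102); [Sprung2017] Thm. 1.12, Cor. 4.4; [Washington1997] §7.1.
-/

set_option autoImplicit false
-- the Theorems namespace of this sub repeats the summit name by design (D-0017 nested layout)
set_option linter.dupNamespace false

noncomputable section

open scoped Classical MatrixGroups ModularForm

open CongruenceSubgroup WeierstrassCurve Literature.NumberTheory.EllipticCurves
  Literature.NumberTheory.EllipticCurves.ModularForms Literature.NumberTheory.EllipticCurves.Sprung2017
  Literature.NumberTheory.EllipticCurves.Rank1Residual
  Literature.NumberTheory.EllipticCurves.Kobayashi2003 ZpExtension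
  Literature.NumberTheory.EllipticCurves.IwasawaDual
  Summit.BirchSwinnertonDyer.Rank1Residual Summit.BirchSwinnertonDyer.Rank1Residual.Supersingular

namespace Summit.BirchSwinnertonDyer.BirchSwinnertonDyer.Theorems

/-! ## §1 Torsion at every pair from finite invariants at the normalised pairs -/

section Torsion

/-- **(T2) from bottom-layer signed control at the normalised pairs.** For `W/ℚ` (globally minimal) and
a sign `ε`: if `Sel^ε(W/ℚ_∞)^γ` (the kernel of `conj_γ − 1` on `signedSelmerInfty`) is FINITE for every
cyclotomic `κ` with top generator `γ` matching the cyclotomic variable (`IsCyclotomicVariable p γ`),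
then EVERY signed dual datum at EVERY cyclotomic `κ` and every `γ` is `Λ`-torsion
(`isTorsion_of_finite_endInvariants` at the tree's normalised pair, then
`isTorsion_of_isTorsion_of_isCyclotomic`). [cite: GreenbergLNM1716, Thm. 1.4 (p. 61) and §4 Lemma 4.2 (p. 102)]
[cite: Kobayashi2003, Thm. 1.2 and Thm. 9.3] -/
theorem signedTorsion_of_finite_invariants_normalised {p : ℕ} [Fact p.Prime] (W : WeierstrassCurve ℚ)
    [W.IsElliptic] (ε : ℤˣ)
    (hInv : ∀ (κ : ZpExtension ℚ p) (γ : Field.absoluteGaloisGroup ℚ),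
      κ.IsCyclotomic → κ.IsTopGenerator γ → IsCyclotomicVariable p γ →
      Finite (endInvariants (conjSignedSelmerInfty W κ ε γ - 1)))
    {κ : ZpExtension ℚ p} {γ : Field.absoluteGaloisGroup ℚ} (hκ : κ.IsCyclotomic)
    (D : SignedSelmerDualData W κ γ ε) :
    Module.IsTorsion (IwasawaAlgebra p) D.X := by
  obtain ⟨κ₀, hκ₀, γ₀, hγ₀, hγ₀'⟩ := exists_isCyclotomic_isTopGenerator_isCyclotomicVariable_holds p
  obtain ⟨D₀⟩ := nonempty_signedSelmerDualData W κ₀ ε hγ₀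
  have hT₀ : Module.IsTorsion (IwasawaAlgebra p) D₀.X :=
    D₀.isTorsion_of_finite_endInvariants hγ₀ (hInv κ₀ γ₀ hκ₀ hγ₀ hγ₀')
  exact SignedSelmerDualData.isTorsion_of_isTorsion_of_isCyclotomic hκ₀ hκ hγ₀ D₀ D hT₀

/-- **Stub (T2_A) of line `rankzero` from finite invariants at normalised pairs** — the registered
signature `stub_torsionCMTwo` (CM `A`, analytic rank `0`, good supersingular at `2`, `a₂ = 0`; every
cyclotomic top-generator pair) follows from `Finite (Sel⁺(A/ℚ_∞)^γ)` at the normalised pairs only.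
[cite: GreenbergLNM1716, Thm. 1.4 (p. 61)] [cite: Kobayashi2003, Thm. 1.2 and Thm. 9.3] -/
theorem torsionCMTwo_of_finite_invariants_normalised
    (hInv : ∀ (A : WeierstrassCurve ℚ) [A.IsElliptic] [A.IsGloballyMinimal],
      A.HasCM → A.analyticRank = 0 → GoodSS A 2 → A.frobeniusTrace 2 = 0 →
      ∀ (κ : ZpExtension ℚ 2) (γ : Field.absoluteGaloisGroup ℚ),
        κ.IsCyclotomic → κ.IsTopGenerator γ → IsCyclotomicVariable 2 γ →
        Finite (endInvariants (conjSignedSelmerInfty A κ 1 γ - 1))) :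
    ∀ (A : WeierstrassCurve ℚ) [A.IsElliptic] [A.IsGloballyMinimal],
      A.HasCM → A.analyticRank = 0 → GoodSS A 2 → A.frobeniusTrace 2 = 0 →
      ∀ (κ : ZpExtension ℚ 2) (γ : Field.absoluteGaloisGroup ℚ), κ.IsCyclotomic → κ.IsTopGenerator γ →
      ∀ D : SignedSelmerDualData A κ γ 1, Module.IsTorsion (IwasawaAlgebra 2) D.X :=
  fun A _ _ hcm hr hss ha _ _ hκ _ D =>
    signedTorsion_of_finite_invariants_normalised A 1 (hInv A hcm hr hss ha) hκ D

end Torsion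

/-! ## §2 The Eisenstein half is free in the unit zone -/

section UnitZone

variable (A : WeierstrassCurve ℚ) [A.IsElliptic] [A.IsGloballyMinimal]

/-- **In the unit zone the Eisenstein half of the `+` main conjecture at `2` is free.** Let `W` be
globally minimal, good at `2` with `a₂ = 0`, `f` a newform of `W` with period ratio `ϖ`
(`ϖ·Ω_W = Ω⁺_f`), and suppose `ord₂ ϖ = 0` and `ord₂ [0]⁺_f = 0` (so `L(W,1)/Ω_W` is a `2`-adic unit —
under BSD₂: `Ш[2] = 0` and `∏c_ℓ` odd). Then for ANY Pollack pair `(L⁺, L⁻)` at `2` and ANY signed dual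
datum `D` with `char X⁺ = (g)` there is `h ∈ Λ` with `ι g = ϖ·ι(L⁻·h)` — the body of
`KobayashiLowerDivisibility W 2 1` at these data — because `L⁻ = L♭` has constant term `[0]⁺_f`
(`c♭ = 1` at `a₂ = 0`), hence is a UNIT of `Λ`, and `ϖ` is a unit of `ℤ₂`: take
`h = g · (L♭)⁻¹ · ϖ⁻¹`. No torsion, no control, no CM is used. [cite: Kobayashi2003, Conjecture (p. 2) and (3.6)]
[cite: Sprung2017, Thm. 1.12 and Cor. 4.4] [cite: Washington1997, §7.1] -/
theorem kobayashiLowerDivisibility_body_of_unitZone_two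
    (hgood : A.HasGoodReductionAtPrime 2) (ha : A.frobeniusTrace 2 = 0)
    {N : ℕ} [NeZero N] {f : CuspForm (Gamma0 N) 2} (hf : IsNewformOf A f)
    {ϖ : ℚ} (hϖ0 : ϖ ≠ 0) (hϖ : padicValRat 2 ϖ = 0) (hs : padicValRat 2 (ratPlusSymbol f 0) = 0)
    (hs0 : ratPlusSymbol f 0 ≠ 0)
    {Lplus Lminus : IwasawaAlgebra 2} (hPP : IsPollackPair f 2 Lplus Lminus)
    (g : IwasawaAlgebra 2) :
    ∃ h : IwasawaAlgebra 2, iwasawaToPowerSeries 2 g =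
      PowerSeries.C (ϖ : ℚ_[2]) * iwasawaToPowerSeries 2 (kobayashiL 1 Lplus Lminus * h) := by
  have hkL : kobayashiL (1 : ℤˣ) Lplus Lminus = Lminus := by unfold kobayashiL; rw [if_pos rfl]
  -- `L⁻(0) = [0]⁺_f` (Sprung, `c♭ = 1` at `a₂ = 0`), a `2`-adic unit: `L⁻ ∈ Λˣ`
  have hSP : IsSprungPair f 2 (A.frobeniusTrace 2) Lplus Lminus := by
    rw [ha]
    exact (isSprungPair_zero_iff f 2 Lplus Lminus).mpr ⟨hPP.2.2.1, hPP.2.2.2⟩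
  have hLf0 := constantCoeff_flat_two_of_isSprungPair_of_isNewformOf hf hgood hSP
  rw [ha] at hLf0
  have hLf0' : ((PowerSeries.constantCoeff Lminus : ℤ_[2]) : ℚ_[2]) = ((ratPlusSymbol f 0 : ℚ) : ℚ_[2]) := by
    rw [hLf0]; push_cast; ring
  have hL0ne : PowerSeries.constantCoeff Lminus ≠ 0 := by
    intro h0
    have : ((ratPlusSymbol f 0 : ℚ) : ℚ_[2]) = 0 := by rw [← hLf0', h0, PadicInt.coe_zero]
    exact hs0 (by exact_mod_cast this)
  have hLunit : IsUnit Lminus :=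
    X1.EisensteinSqueeze.isUnit_of_valuation_constantCoeff_eq_zero hL0ne
      (by rw [hLf0', Padic.valuation_ratCast, hs])
  -- `ϖ ∈ ℤ₂ˣ`: `ϖ = ι u` for a unit `u` of `ℤ₂`
  have hϖQ : (ϖ : ℚ_[2]) ≠ 0 := by exact_mod_cast hϖ0
  have hnormϖ : ‖(ϖ : ℚ_[2])‖ = 1 := by
    rw [Padic.norm_eq_zpow_neg_valuation hϖQ, Padic.valuation_ratCast, hϖ, neg_zero, zpow_zero]
  set u : ℤ_[2] := ⟨(ϖ : ℚ_[2]), hnormϖ.le⟩ with hu_def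
  have hu : IsUnit u := PadicInt.isUnit_iff.mpr hnormϖ
  obtain ⟨uL, huL⟩ := hLunit
  obtain ⟨uϖ, huϖ⟩ := hu
  refine ⟨g * ↑uL⁻¹ * PowerSeries.C (↑uϖ⁻¹ : ℤ_[2]), ?_⟩
  rw [hkL, ← huL]
  -- `ϖ · ι(uL · (g · uL⁻¹ · C uϖ⁻¹)) = ι g`
  have hCϖ : PowerSeries.C (ϖ : ℚ_[2]) = iwasawaToPowerSeries 2 (PowerSeries.C u) := by
    simp [iwasawaToPowerSeries, PowerSeries.map_C, hu_def]
  rw [hCϖ, ← map_mul, ← huϖ]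
  congr 1
  calc g = g * ((↑uL * ↑uL⁻¹) * PowerSeries.C ((↑uϖ * ↑uϖ⁻¹ : ℤ_[2]))) := by
          rw [Units.mul_inv, Units.mul_inv, map_one, mul_one, mul_one]
    _ = PowerSeries.C (↑uϖ : ℤ_[2]) * (↑uL * (g * ↑uL⁻¹ * PowerSeries.C (↑uϖ⁻¹ : ℤ_[2]))) := by
          rw [map_mul]; ring

end UnitZone

end Summit.BirchSwinnertonDyer.BirchSwinnertonDyer.Theorems

end
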